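import Literature.Analysis.OperatorTheory.KreinStewartFiniteDim

/-!
# Kreĭn–Stewart definitization: compression to finite-dimensional pieces

The radical, projections onto finite orthogonal families of non-isotropic vectors, the
enlargement lemma `KreinStewart.exists_orthFam` (every finite set of vectors lies, modulo the
radical, in the span of such a family), and the compression step
`KreinStewart.exists_poly_finset`: the finite-dimensional theorem `KreinStewart.fd` applied to the
compression `proj ∘ T` yields, for every finite set of vectors, a definitizing polynomial of the
symmetric operator `T` on those vectors (Stewart 1972, proof of Thm. 3.1, with the completion and
Pontryagin's theorem replaced by compressions). See `KreinStewartDefs` for the overview.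
-/

open scoped ComplexConjugate
open Module Polynomial

namespace Literature.Analysis.OperatorTheory.KreinStewart

variable {V : Type*} [AddCommGroup V] [Module ℂ V] {B : HForm V}

/-- Radical vectors pair to zero on the left. [folklore] -/
theorem rad_apply_left {x : V} (hx : x ∈ rad B) (y : V) : B x y = 0 := mem_rad.1 hx y

/-- Radical vectors pair to zero on the right. [folklore] -/
theorem rad_apply_right (hB : B.IsSymm) {x : V} (hx : x ∈ rad B) (y : V) : B y x = 0 :=
  apply_eq_zero_comm hB (rad_apply_left hx y)

/-- Vectors of the radical do not change `B a a`. [folklore] -/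
theorem apply_sub_rad_self (hB : B.IsSymm) {a ρ : V} (hρ : ρ ∈ rad B) :
    B (a - ρ) (a - ρ) = B a a := by
  simp [map_sub, rad_apply_left hρ, rad_apply_right hB hρ]

/-- A symmetric operator preserves the radical. [folklore] -/
theorem symOp_rad {T : V →ₗ[ℂ] V} (hT : IsSymOp B T) {ρ : V} (hρ : ρ ∈ rad B) : T ρ ∈ rad B :=
  mem_rad.2 fun y => by rw [hT, rad_apply_left hρ]

/-- `B q (proj x) = B q x` for `q` in the family. [folklore] -/
theorem apply_proj_of_mem {b : Finset V} (hb : OrthFam B b) {q : V} (hq : q ∈ b) (x : V) :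
    B q (proj B b x) = B q x := by
  rw [proj, map_sum, Finset.sum_eq_single q]
  · rw [map_smul, smul_eq_mul, div_mul_cancel₀ _ (hb.2 q hq)]
  · intro p hp hpq
    rw [map_smul, hb.1 q hq p hp (Ne.symm hpq), smul_zero]
  · intro hq'
    exact absurd hq hq'

/-- `x - proj x` is orthogonal to the family. [folklore] -/
theorem apply_sub_proj_of_mem {b : Finset V} (hb : OrthFam B b) {q : V} (hq : q ∈ b) (x : V) :
    B q (x - proj B b x) = 0 := by
  rw [map_sub, apply_proj_of_mem hb hq, sub_self]

/-- A vector orthogonal to the family is orthogonal to all projections. [folklore] -/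
theorem apply_proj_of_orth (hB : B.IsSymm) {b : Finset V} {z : V} (hz : ∀ q ∈ b, B q z = 0)
    (x : V) : B z (proj B b x) = 0 := by
  rw [proj, map_sum]
  refine Finset.sum_eq_zero fun p hp => ?_
  rw [map_smul, apply_eq_zero_comm hB (hz p hp), smul_zero]

/-- Projection onto an enlarged family. [folklore] -/
theorem proj_insert [DecidableEq V] {b : Finset V} {p : V} (hp : p ∉ b) (x : V) :
    proj B (insert p b) x = proj B b x + (B p x / B p p) • p := by
  rw [proj, Finset.sum_insert hp, add_comm]
  rfl

/-- Inserting a non-isotropic vector orthogonal to the family. [folklore] -/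
theorem orthFam_insert [DecidableEq V] (hB : B.IsSymm) {b : Finset V} (hb : OrthFam B b) {p : V}
    (hp : ∀ q ∈ b, B q p = 0) (hpp : B p p ≠ 0) :
    p ∉ b ∧ OrthFam B (insert p b) ∧
      ∀ y, y - proj B b y ∈ rad B → y - proj B (insert p b) y ∈ rad B := by
  have hpb : p ∉ b := fun h => hpp (hp p h)
  refine ⟨hpb, ⟨?_, ?_⟩, ?_⟩
  · intro x hx y hy hxy
    rcases Finset.mem_insert.1 hx with rfl | hxb
    · rcases Finset.mem_insert.1 hy with rfl | hyb
      · exact absurd rfl hxy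
      · exact apply_eq_zero_comm hB (hp y hyb)
    · rcases Finset.mem_insert.1 hy with rfl | hyb
      · exact hp x hxb
      · exact hb.1 x hxb y hyb hxy
  · intro x hx
    rcases Finset.mem_insert.1 hx with rfl | hxb
    · exact hpp
    · exact hb.2 x hxb
  · intro y hy
    have hpy : B p y = 0 := by
      have : y = proj B b y + (y - proj B b y) := by abel
      rw [this, map_add, apply_proj_of_orth hB hp, rad_apply_right hB hy, add_zero]
    rw [proj_insert hpb, hpy, zero_div, zero_smul, add_zero]
    exact hy

/-- **Enlargement lemma.** Any finite set of vectors lies, modulo the radical, in the span of a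
finite orthogonal family of non-isotropic vectors. [folklore] -/
theorem exists_orthFam (hB : B.IsSymm) (t : Finset V) :
    ∃ b : Finset V, OrthFam B b ∧ ∀ x ∈ t, x - proj B b x ∈ rad B := by
  classical
  induction t using Finset.induction_on with
  | empty => exact ⟨∅, ⟨by simp, by simp⟩, by simp⟩
  | insert x t _ ih =>
    obtain ⟨b, hb, hgood⟩ := ih
    set w := x - proj B b x with hwdef
    have hw : ∀ q ∈ b, B q w = 0 := fun q hq => apply_sub_proj_of_mem hb hq x
    have hxw : x = proj B b x + w := by rw [hwdef]; abel
    by_cases hrad : w ∈ rad B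
    · refine ⟨b, hb, fun y hy => ?_⟩
      rcases Finset.mem_insert.1 hy with rfl | hy
      · exact hrad
      · exact hgood y hy
    by_cases hww : B w w ≠ 0
    · obtain ⟨hwb, hb', hgood'⟩ := orthFam_insert hB hb hw hww
      refine ⟨insert w b, hb', fun y hy => ?_⟩
      rcases Finset.mem_insert.1 hy with rfl | hy
      · have hwx : B w y = B w w := by
          conv_lhs => rw [hxw]
          rw [map_add, apply_proj_of_orth hB hw, zero_add]
        rw [proj_insert hwb, hwx, div_self hww, one_smul, ← sub_sub, ← hwdef, sub_self]
        exact zero_mem _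
      · exact hgood' y (hgood y hy)
    · push Not at hww
      have hz : ∃ z, B w z ≠ 0 := by
        by_contra hcon
        push Not at hcon
        exact hrad (mem_rad.2 hcon)
      obtain ⟨z, hz⟩ := hz
      -- a vector `z₂ ⊥ b` with `B w z₂ = 1`
      obtain ⟨z₂, hz₂b, h1, h1'⟩ : ∃ z₂ : V, (∀ q ∈ b, B q z₂ = 0) ∧ B w z₂ = 1 ∧ B z₂ w = 1 := by
        have hwz : B w (z - proj B b z) = B w z := by
          rw [map_sub, apply_proj_of_orth hB hw, sub_zero]
        have h1 : B w ((B w z)⁻¹ • (z - proj B b z)) = 1 := by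
          rw [map_smul, hwz, smul_eq_mul, inv_mul_cancel₀ hz]
        refine ⟨(B w z)⁻¹ • (z - proj B b z), fun q hq => ?_, h1, ?_⟩
        · rw [map_smul, apply_sub_proj_of_mem hb hq, smul_zero]
        · rw [apply_comm hB, h1, map_one]
      set γ : ℂ := B z₂ z₂ with hγdef
      have hγ : conj γ = γ := hB.eq z₂ z₂
      set α : ℂ := 1 - γ / 2 with hαdef
      have hα : conj α = α := by
        rw [hαdef, map_sub, map_one, map_div₀, hγ, map_ofNat]
      set p : V := z₂ + α • w with hpdef
      have hpb : ∀ q ∈ b, B q p = 0 := by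
        intro q hq
        rw [hpdef, map_add, map_smul, hz₂b q hq, hw q hq, smul_zero, add_zero]
      have hpp : B p p = 2 := by
        rw [hpdef]
        simp only [map_add, map_smul, LinearMap.map_smulₛₗ₂, LinearMap.add_apply,
          smul_eq_mul, h1, h1', hww, hα, mul_zero, add_zero, mul_one]
        rw [← hγdef, hαdef]
        ring
      have hpw : B p w = 1 := by
        rw [hpdef, LinearMap.map_add₂, LinearMap.map_smulₛₗ₂, h1', hww, smul_zero, add_zero]
      have hwp : B w p = 1 := by rw [apply_comm hB, hpw, map_one]
      set q : V := w - (1 / 2 : ℂ) • p with hqdef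
      have hqb : ∀ q' ∈ b, B q' q = 0 := by
        intro q' hq'
        rw [hqdef, map_sub, map_smul, hw q' hq', hpb q' hq', smul_zero, sub_zero]
      have hpq : B p q = 0 := by
        rw [hqdef, map_sub, map_smul, hpw, hpp, smul_eq_mul]
        norm_num
      have hqp : B q p = 0 := apply_eq_zero_comm hB hpq
      have hqw : B q w = -1 / 2 := by
        rw [hqdef, LinearMap.map_sub₂, LinearMap.map_smulₛₗ₂, hww, hpw, smul_eq_mul, mul_one,
          map_div₀, map_one, map_ofNat]
        norm_num
      have hqq : B q q = -1 / 2 := by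
        have : B q q = B q w - (1 / 2 : ℂ) * B q p := by
          conv_lhs => rw [hqdef]
          rw [map_sub, map_smul, smul_eq_mul]
        rw [this, hqw, hqp, mul_zero, sub_zero]
      obtain ⟨hpb', hb1, hgood1⟩ := orthFam_insert hB hb hpb (by rw [hpp]; norm_num)
      have hqpb : ∀ q' ∈ insert p b, B q' q = 0 := by
        intro q' hq'
        rcases Finset.mem_insert.1 hq' with rfl | hq'
        · exact hpq
        · exact hqb q' hq'
      obtain ⟨hqb', hb2, hgood2⟩ := orthFam_insert hB hb1 hqpb (by rw [hqq]; norm_num)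
      refine ⟨insert q (insert p b), hb2, fun y hy => ?_⟩
      rcases Finset.mem_insert.1 hy with rfl | hy
      · have hpx : B p y = 1 := by
          conv_lhs => rw [hxw]
          rw [map_add, apply_proj_of_orth hB hpb, zero_add, hpw]
        have hqx : B q y = -1 / 2 := by
          conv_lhs => rw [hxw]
          rw [map_add, apply_proj_of_orth hB hqb, zero_add, hqw]
        rw [proj_insert hqb', proj_insert hpb', hpx, hqx, hpp, hqq, div_self (by norm_num),
          one_smul]
        have : y - (proj B b y + (1 / 2 : ℂ) • p + q) = 0 := by
          rw [hqdef, hwdef]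
          module
        rw [this]
        exact zero_mem _
      · exact hgood2 y (hgood1 y (hgood y hy))

/-- **Compression step.** For a symmetric `T` on a space with at most `κ` negative squares and any
finite set `s` of vectors, a non-zero polynomial `P` of degree `≤ κ` makes `B (P(T)v) (P(T)v) ≥ 0`
for all `v ∈ s`. [folklore] -/
theorem exists_poly_finset (hB : B.IsSymm) {T : V →ₗ[ℂ] V} (hT : IsSymOp B T) {κ : ℕ}
    (h : NegSqLE B κ) (s : Finset V) :
    ∃ P : ℂ[X], P ≠ 0 ∧ P.natDegree ≤ κ ∧ ∀ v ∈ s, 0 ≤ (B (aeval T P v) (aeval T P v)).re := by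
  classical
  -- targets and the orthogonal family
  set t : Finset V := Finset.image (fun vj : V × ℕ => (T ^ vj.2) vj.1) (s ×ˢ Finset.range (κ + 1))
    with htdef
  obtain ⟨b, hb, hgood⟩ := exists_orthFam hB t
  have hgood' : ∀ v ∈ s, ∀ j ≤ κ, (T ^ j) v - proj B b ((T ^ j) v) ∈ rad B := by
    intro v hv j hj
    apply hgood
    rw [htdef, Finset.mem_image]
    exact ⟨(v, j), Finset.mem_product.2 ⟨hv, Finset.mem_range.2 (Nat.lt_succ_of_le hj)⟩, rfl⟩
  -- the finite-dimensional compression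
  set φ : (b → ℂ) →ₗ[ℂ] V := Fintype.linearCombination ℂ (fun p : b => (p : V)) with hφdef
  have hφ : ∀ ξ : b → ℂ, φ ξ = ∑ p : b, ξ p • (p : V) := fun ξ => rfl
  have hφproj : ∀ x : V, φ (fun q : b => B q x / B q q) = proj B b x := by
    intro x
    rw [hφ, proj]
    exact Finset.sum_coe_sort b (fun p => (B p x / B p p) • p)
  set AE : (b → ℂ) →ₗ[ℂ] (b → ℂ) :=
    LinearMap.pi (fun q : b => (B (q : V) q)⁻¹ • (B (q : V) ∘ₗ T ∘ₗ φ)) with hAEdef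
  have hAE : ∀ ξ : b → ℂ, AE ξ = fun q : b => B q (T (φ ξ)) / B q q := by
    intro ξ
    ext q
    rw [hAEdef, LinearMap.pi_apply, LinearMap.smul_apply, LinearMap.coe_comp, LinearMap.coe_comp,
      Function.comp_apply, Function.comp_apply, smul_eq_mul, div_eq_inv_mul]
  have hφAE : ∀ ξ, φ (AE ξ) = proj B b (T (φ ξ)) := by
    intro ξ
    rw [hAE, hφproj]
  -- `B (proj z) y = B z y` for `y` in the span of `b`
  have hprojspan : ∀ (z : V) (η : b → ℂ), B (proj B b z) (φ η) = B z (φ η) := by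
    intro z η
    rw [hφ, map_sum, map_sum]
    refine Finset.sum_congr rfl fun q _ => ?_
    rw [map_smul, map_smul, apply_comm hB, apply_proj_of_mem hb q.2, ← apply_comm hB]
  have hsym : IsSymOp (pb B φ) AE := by
    intro ξ η
    rw [pb_apply, pb_apply, hφAE, hφAE, hprojspan, hT, apply_comm hB (proj B b (T (φ η))) (φ ξ),
      hprojspan, ← apply_comm hB]
  obtain ⟨P, hP0, hPdeg, hP⟩ := fd κ (isSymm_pb hB φ) hsym (h.comap φ)
  refine ⟨P, hP0, hPdeg, fun v hv => ?_⟩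
  -- transfer along the chain `ξ j ↦ proj (T^j v)`
  set ξ : ℕ → (b → ℂ) := fun j q => B q ((T ^ j) v) / B q q with hξdef
  have hφξ : ∀ j, φ (ξ j) = proj B b ((T ^ j) v) := fun j => hφproj _
  obtain ⟨ρ, hρdef⟩ : ∃ ρ : ℕ → V, ∀ j, ρ j = (T ^ j) v - proj B b ((T ^ j) v) :=
    ⟨_, fun j => rfl⟩
  have hρ : ∀ j ≤ κ, ρ j ∈ rad B := fun j hj => by rw [hρdef]; exact hgood' v hv j hj
  have hφξ' : ∀ j, φ (ξ j) = (T ^ j) v - ρ j := by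
    intro j
    rw [hφξ, hρdef, sub_sub_cancel]
  have hstep : ∀ j < κ, AE (ξ j) = ξ (j + 1) := by
    intro j hj
    rw [hAE]
    funext q
    show B q (T (φ (ξ j))) / B q q = B q ((T ^ (j + 1)) v) / B q q
    rw [hφξ', map_sub, map_sub, rad_apply_right hB (symOp_rad hT (hρ j hj.le)), sub_zero,
      ← Module.End.mul_apply, ← pow_succ']
  have hpow : ∀ j ≤ κ, (AE ^ j) (ξ 0) = ξ j := by
    intro j hj
    induction j with
    | zero => simp
    | succ j ih => rw [pow_succ', Module.End.mul_apply, ih (Nat.le_of_succ_le hj),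
        hstep j (Nat.lt_of_succ_le hj)]
  have hdeg : P.natDegree < κ + 1 := Nat.lt_succ_of_le hPdeg
  have h1 : aeval AE P (ξ 0) = ∑ j ∈ Finset.range (κ + 1), P.coeff j • ξ j := by
    rw [aeval_eq_sum_range' hdeg, LinearMap.sum_apply]
    refine Finset.sum_congr rfl fun j hj => ?_
    rw [LinearMap.smul_apply, hpow j (Nat.lt_succ_iff.1 (Finset.mem_range.1 hj))]
  have h2 : aeval T P v = ∑ j ∈ Finset.range (κ + 1), P.coeff j • (T ^ j) v := by
    rw [aeval_eq_sum_range' hdeg, LinearMap.sum_apply]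
    rfl
  have h3 : φ (aeval AE P (ξ 0)) = aeval T P v - ∑ j ∈ Finset.range (κ + 1), P.coeff j • ρ j := by
    rw [h1, h2, map_sum, ← Finset.sum_sub_distrib]
    refine Finset.sum_congr rfl fun j _ => ?_
    rw [map_smul, hφξ', smul_sub]
  have h4 : ∑ j ∈ Finset.range (κ + 1), P.coeff j • ρ j ∈ rad B :=
    Submodule.sum_mem _ fun j hj =>
      Submodule.smul_mem _ _ (hρ j (Nat.lt_succ_iff.1 (Finset.mem_range.1 hj)))
  have key := hP (ξ 0)
  rwa [pb_apply, h3, apply_sub_rad_self hB h4] at key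

end Literature.Analysis.OperatorTheory.KreinStewart
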